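import Literature.MathematicalPhysics.QuantumFieldTheory.Balaban1983to89.B9Ineq385VG
import Literature.MathematicalPhysics.QuantumFieldTheory.Balaban1983to89.B9Ineq363L2

/-!
# `Balaban1983to89.B9Ineq383L2` — [Balaban1985BackgroundPropagators] (3.83) p. 407 AND THE `P₂(A)` THIRD OF (3.85) IN THE BLOCK-`ℓ²` CURRENCY OF (3.46):
# `P₂(A) = −(F₂*aQ + Q*aF₂ + F₂*aF₂) ≺₂ κ₃₈₃·α₁(Lʲη)⁻²e^{−ρd}` from block-`ℓ²` sizes of the averaging letters `Q, Q*`, the expansion letters `F₂, F₂*` and the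
# weight letter `a`, and the three composites `P₂·G`, `G·P₂`, `∇G·P₂` with THEOREM 3.3's `L²` members at U — fourth brick of the kernel-free `ℓ²` route to
# the (3.46) members of `G(U′U)` displayed in `B9SectBStepFrameV4.SectBFrame₄` (the `ℓ²` twin of r06's `B9Ineq385VG.ineq383_op` and of the `P₂`-words of
# `ineq385_op`)

T. Bałaban, *Propagators for lattice gauge theories in a background field*, Commun. Math. Phys. **99** (1985) 389–434
[`Balaban1985BackgroundPropagators`, "B9"]; [4] = T. Bałaban, *Propagators and renormalization transformations for lattice gauge theories. II*,
Commun. Math. Phys. **96** (1984) 223–250 [`Balaban1984PropagatorsII`].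

statement-level skeleton of published theorems with citation tags; proofs where landed; nothing here is a claim about the Yang–Mills mass gap

THE PRINTED LOCUS (verbatim, p. 407).  *"The operator P₂(A) is a sum of three terms obtained by the expansion of averaging operators. It is a semi-local
operator in the sense that the value (P₂(A)A′)(b) at a bond b ∈ B^j(Λ_j) depends on A, A′ restricted to j-blocks neighbouring the block containing the bond
b. It satisfies the bound |(P₂(A)A′)(b)| ≤ O(1)α₁(L^jη)^{−2}|A′|, b ∈ B^j(Λ_j), (3.83) with the norm |A′| restricted to the blocks defined above. … Using the
bounds (3.73), (3.77), (3.83) and assuming that Theorem 3.3 holds for G(U), we get |(V(A)G(U)J)(b)| ≤ O(1)α₁e^{−(1/2)δ₀d(y,y′)}|J| … (3.85) … Theorem (3.3)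
implies also convergence in all norms appearing in its formulation"*; (3.80)–(3.81) p. 406 (`Q(U′U) = Q(U) + F₂(A)`, «|F_{2,j}(A)A′| ≤ O(1)α₁Q″_j|A′|»);
(3.24)/(3.26) pp. 394–395 (the weight `a`).

WHY THIS FILE (pub-ymgap N06 row 13, seat dag-n06-c g5).  (3.85) in the block-`ℓ²` form is the input of the six displayed `L²` member-steps of `G(U′U)`
(`B9SectBStepFrameV4.SectBFrame₄.stepL2G`); `V(A) = V₃(A) + P₁(A) + P₂(A)`; the `V₃` third is `B9Ineq385L2V3` ∕ `B9Ineq385L2V3Right`; THIS FILE is the `P₂`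
third.  A sup block majorant of a SEMI-LOCAL (block-range) letter does NOT bound its block-`ℓ²` norm (the stencil is a whole block), so the `ℓ²` sizes of
`Q, Q*, F₂, F₂*, a` are INPUTS here (readings an instance owes from its own concrete letters — at the record `Q, Q*` are explicit averaging kernels and `a`
is diagonal), in the same printed shapes as r06's sup inputs `hQb hQsb hF₂ ha324` of `B9SectBGStepAtLettersV2.GFrame₂`.

WHAT IS PROVED (theorems only; 0 sorry; standard axioms; no definition; the constant is r06's `B9Ineq385VG.kappa383`).
* §1 `hasL2Majorant_diag_mul` (a block-diagonal weight letter on the left: `T₁ ≺₂ w(y)𝟙[y=y′]`, `T₂ ≺₂ K` ⟹ `T₁T₂ ≺₂ w(y)K`).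
* §2 ★★ `ineq383_l2` — `pTwo Qs Q F₂ F₂s a ≺₂ κ₃₈₃(κ_Q, c_F, ā, Λ, c₁(β), α₁)·α₁·(Lʲη)⁻²·e^{−ρd}` from `Q, Q* ≺₂ κ_Qe^{−δd}`, `F₂, F₂* ≺₂ c_Fα₁e^{−δd}`,
  `a ≺₂ ā(Lʲη)⁻²𝟙[y=y′]`, the transfer of `(Lʲη)⁻²` at `α`, (2.61) at `β`, `ρ + (α+β)δ₀ ≦ δ` — r06's `ineq383_op` VERBATIM in the `ℓ²` calculus
  (`B9Ineq363L2.hasL2Majorant_comp_decay` with the left weight `1`).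
* §3 ★ `ineq385_l2_P2G` (`P₂·G ≺₂ κ₃₈₃B₀Λ′c₁(β′)·α₁·e^{−ρ′d}` from `G ≺₂ B₀(Lʲη)²e^{−ρd}`), ★ `ineq385_l2_GP2` (`G·P₂ ≺₂ …·α₁·e^{−ρ′d}`, transfer of `(Lʲη)⁻²`),
  ★ `ineq385_l2_XP2` (`X·P₂ ≺₂ …·α₁·(Lʲη)⁻¹·e^{−ρ′d}` for `X ≺₂ B₀Lʲη e^{−ρd}` — print: `X = ∇_kG(U)`, the mixed member's factor), all with
  `ρ′ + (α′+β′)δ₀ ≦ ρ`.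

HONEST SCOPE.  Finite-dimensional bookkeeping; every letter is a binder with its size as hypothesis; nothing of [B9] is asserted for Bałaban's operators;
count-neutral; NOT a node discharge; nothing continuum ∕ OS ∕ mass-gap ∕ Clay.  Cell `pub-ymgap` (HUMAN RULING D-0062), Track A node N06 [B9], N06-ASSIGNMENT row 13,
seat `pub-ymgap-dag-n06-c` (g5), 2026-08-27.  NOT HERE: the `P₁(A)` third (the (3.49)/(3.68) entries in `ℓ²` through the site lattice) and the assembly.
-/

noncomputable section

open scoped BigOperators

namespace Literature.MathematicalPhysics.QuantumFieldTheory.Balaban1983to89.B9Ineq383L2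

open Literature.MathematicalPhysics.QuantumFieldTheory.Balaban1983to89
open Literature.MathematicalPhysics.QuantumFieldTheory.Balaban1983to89.B6RandomWalk (Triangle254 Ineq261)
open Literature.MathematicalPhysics.QuantumFieldTheory.Balaban1983to89.B6RandomWalkL2 (HasL2Majorant hasL2Majorant_mono hasL2Majorant_add
  hasL2Majorant_mul)
open Literature.MathematicalPhysics.QuantumFieldTheory.Balaban1983to89.B9Thm34Ext (toB6)
open Literature.MathematicalPhysics.QuantumFieldTheory.Balaban1983to89.B9Ineq347 (ScaleTransfer)
open Literature.MathematicalPhysics.QuantumFieldTheory.Balaban1983to89.B9Eq386Neumann (pTwo)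
open Literature.MathematicalPhysics.QuantumFieldTheory.Balaban1983to89.B9Ineq385VG (pTwo_assoc kappa383 kappa383_nonneg)
open Literature.MathematicalPhysics.QuantumFieldTheory.Balaban1983to89.B9Ineq361L2Letters (hasL2Majorant_neg)
open Literature.MathematicalPhysics.QuantumFieldTheory.Balaban1983to89.B9Ineq363L2 (hasL2Majorant_comp_decay hasL2Majorant_rate_mono)

variable {g : B9.Geometry} [Fintype g.Site] [DecidableEq g.Site] {R : ℝ} {H : Prop} {W : Type} [Fintype W]

/-! ## §1  A block-diagonal weight letter on the left, in ℓ² -/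

/-- A DIAGONAL WEIGHT letter on the left in the `ℓ²` calculus (the `a` of `Q*aQ`, (3.24)/(3.26)): `T₁ ≺₂ w(y)𝟙[y = y′]`, `T₂ ≺₂ K ≧ 0` ⟹ `T₁T₂ ≺₂ w(y)K(y,y′)`
(the `ℓ²` twin of `B9Ineq385VG.hasMajorant_diag_mul`). [cite: Balaban1985BackgroundPropagators, (3.24) p.394 + (3.26) p.395; Balaban1984PropagatorsII, (2.52) p.232 + Prop. 2.6 (2.140) p.247] -/
theorem hasL2Majorant_diag_mul (blk : W → g.Site) {T₁ T₂ : Module.End ℝ (W → ℝ)} {w : g.Site → ℝ} (hw : ∀ a, 0 ≤ w a)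
    {K : g.Site → g.Site → ℝ}
    (h₁ : HasL2Majorant (g := toB6 g R H) blk T₁ (fun a b : g.Site => if a = b then w a else 0))
    (h₂ : HasL2Majorant (g := toB6 g R H) blk T₂ K) :
    HasL2Majorant (g := toB6 g R H) blk (T₁ * T₂) (fun a b => w a * K a b) := by
  have hK₁ : ∀ a b : g.Site, 0 ≤ (if a = b then w a else 0) := fun a b => by split_ifs <;> simp [hw a]
  refine hasL2Majorant_mono (g := toB6 g R H) blk (hasL2Majorant_mul (g := toB6 g R H) blk h₁ h₂ hK₁) fun a b => le_of_eq ?_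
  simp [ite_mul]

/-! ## §2  (3.83) in block-ℓ² form -/

/-- ★★ **(3.83) p. 407 IN THE BLOCK-`ℓ²` FORM** for the PRINTED `P₂(A) = B9Eq386Neumann.pTwo Qs Q F₂ F₂s a = −(F₂*(A)aQ(U) + Q*(U)aF₂(A) + F₂*(A)aF₂(A))`:
INPUTS at a common rate `δ` — block-`ℓ²` majorants of the averaging letters `Q, Q* ≺₂ κ_Qe^{−δd}`, of the expansion letters `F₂, F₂* ≺₂ c_Fα₁e^{−δd}` ((3.81)),
of the diagonal weight letter `a ≺₂ ā(Lʲη)⁻²𝟙[y = y′]` ((3.24)/(3.26)), the scale transfer of `(Lʲη)⁻²` at `α` (constant `Λ ≧ 0`), (2.61) at `β`;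
CONCLUSION: for `ρ ≧ 0` with `ρ + (α+β)δ₀ ≦ δ`, `P₂(A) ≺₂ κ₃₈₃·α₁·(Lʲη)⁻²·e^{−ρd}` with r06's EXPLICIT `κ₃₈₃` (`B9Ineq385VG.kappa383`) — the `ℓ²`
twin of `B9Ineq385VG.ineq383_op`, same three words, one composition each.
[cite: Balaban1985BackgroundPropagators, (3.82)–(3.83) p.407 + (3.80)–(3.81) p.406 + (3.24) p.394; Balaban1984PropagatorsII, Lemma 2.1 p.234 + (2.52)–(2.55) p.232 + Prop. 2.6 (2.140)–(2.141) p.247] -/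
theorem ineq383_l2 (blk : W → g.Site) (d : ℕ) (δ₀ δ α β ρ Λ κQ cF abar α₁ : ℝ)
    (hκQ : 0 ≤ κQ) (hcF : 0 ≤ cF) (habar : 0 ≤ abar) (hα₁ : 0 ≤ α₁) (hΛ : 0 ≤ Λ) (hρ : 0 ≤ ρ) (hα : 0 ≤ α)
    (hβ : 0 ≤ β) (hδ₀ : 0 ≤ δ₀) (hr : ρ + (α + β) * δ₀ ≤ δ)
    (hdnn : ∀ a b : g.Site, 0 ≤ g.dist a b) (htri : Triangle254 (toB6 g R H))
    (h261 : Ineq261 d (toB6 g R H) δ₀ β) (hT2i : ScaleTransfer g δ₀ α Λ (fun a => (g.len a ^ 2)⁻¹))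
    {Qs Q F₂ F₂s Aop : Module.End ℝ (W → ℝ)}
    (hQ : HasL2Majorant (g := toB6 g R H) blk Q (fun a b => κQ * Real.exp (-(δ * g.dist a b))))
    (hQs : HasL2Majorant (g := toB6 g R H) blk Qs (fun a b => κQ * Real.exp (-(δ * g.dist a b))))
    (hF : HasL2Majorant (g := toB6 g R H) blk F₂ (fun a b => cF * α₁ * Real.exp (-(δ * g.dist a b))))
    (hFs : HasL2Majorant (g := toB6 g R H) blk F₂s (fun a b => cF * α₁ * Real.exp (-(δ * g.dist a b))))
    (hA : HasL2Majorant (g := toB6 g R H) blk Aop (fun a b : g.Site => if a = b then abar * (g.len a ^ 2)⁻¹ else 0)) :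
    HasL2Majorant (g := toB6 g R H) blk (pTwo Qs Q F₂ F₂s Aop)
      (fun a b => kappa383 κQ cF abar Λ (B6.c1 d δ₀ β) α₁ * α₁ * (g.len a ^ 2)⁻¹ * Real.exp (-(ρ * g.dist a b))) := by
  set c : ℝ := B6.c1 d δ₀ β with hc_def
  have hw2 : ∀ a : g.Site, 0 ≤ (g.len a ^ 2)⁻¹ := fun a => inv_nonneg.mpr (sq_nonneg _)
  have hw0 : ∀ _a : g.Site, 0 ≤ (1 : ℝ) := fun _ => zero_le_one
  have hcFα : 0 ≤ cF * α₁ := mul_nonneg hcF hα₁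
  have hρδ : ρ ≤ δ := by
    have : 0 ≤ (α + β) * δ₀ := by positivity
    linarith
  -- rate-weakened right letters
  have hQρ : HasL2Majorant (g := toB6 g R H) blk Q (fun a b => κQ * Real.exp (-(ρ * g.dist a b))) :=
    hasL2Majorant_mono (g := toB6 g R H) blk hQ fun a b =>
      mul_le_mul_of_nonneg_left (Real.exp_le_exp.mpr (by nlinarith [hdnn a b])) hκQ
  have hFρ : HasL2Majorant (g := toB6 g R H) blk F₂ (fun a b => cF * α₁ * Real.exp (-(ρ * g.dist a b))) :=
    hasL2Majorant_mono (g := toB6 g R H) blk hF fun a b =>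
      mul_le_mul_of_nonneg_left (Real.exp_le_exp.mpr (by nlinarith [hdnn a b])) hcFα
  -- the weight letter composed with its right neighbour
  have hAQ : HasL2Majorant (g := toB6 g R H) blk (Aop * Q)
      (fun a b => (κQ * abar) * (g.len a ^ 2)⁻¹ * Real.exp (-(ρ * g.dist a b))) := by
    refine hasL2Majorant_mono (g := toB6 g R H) blk
      (hasL2Majorant_diag_mul (R := R) (H := H) blk (fun a => mul_nonneg habar (hw2 a)) hA hQρ) fun a b => le_of_eq ?_
    ring
  have hAF : HasL2Majorant (g := toB6 g R H) blk (Aop * F₂)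
      (fun a b => (cF * α₁ * abar) * (g.len a ^ 2)⁻¹ * Real.exp (-(ρ * g.dist a b))) := by
    refine hasL2Majorant_mono (g := toB6 g R H) blk
      (hasL2Majorant_diag_mul (R := R) (H := H) blk (fun a => mul_nonneg habar (hw2 a)) hA hFρ) fun a b => le_of_eq ?_
    ring
  -- the left letters in the shape `A·1·e^{−δd}`
  have hFs' : HasL2Majorant (g := toB6 g R H) blk F₂s (fun a b => (cF * α₁) * (1 : ℝ) * Real.exp (-(δ * g.dist a b))) :=
    hasL2Majorant_mono (g := toB6 g R H) blk hFs fun a b => le_of_eq (by ring)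
  have hQs' : HasL2Majorant (g := toB6 g R H) blk Qs (fun a b => κQ * (1 : ℝ) * Real.exp (-(δ * g.dist a b))) :=
    hasL2Majorant_mono (g := toB6 g R H) blk hQs fun a b => le_of_eq (by ring)
  -- the three words, one composition each
  have w1 := hasL2Majorant_comp_decay (R := R) (H := H) blk d δ₀ α β ρ δ Λ (cF * α₁) (κQ * abar) (fun _ => (1 : ℝ))
    (fun a => (g.len a ^ 2)⁻¹) hw0 hw2 hΛ hcFα (mul_nonneg hκQ habar) hρ hr hdnn htri hT2i h261 hFs' hAQ
  have w2 := hasL2Majorant_comp_decay (R := R) (H := H) blk d δ₀ α β ρ δ Λ κQ (cF * α₁ * abar) (fun _ => (1 : ℝ))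
    (fun a => (g.len a ^ 2)⁻¹) hw0 hw2 hΛ hκQ (mul_nonneg hcFα habar) hρ hr hdnn htri hT2i h261 hQs' hAF
  have w3 := hasL2Majorant_comp_decay (R := R) (H := H) blk d δ₀ α β ρ δ Λ (cF * α₁) (cF * α₁ * abar) (fun _ => (1 : ℝ))
    (fun a => (g.len a ^ 2)⁻¹) hw0 hw2 hΛ hcFα (mul_nonneg hcFα habar) hρ hr hdnn htri hT2i h261 hFs' hAF
  have hsum := hasL2Majorant_neg (Rr := R) (H := H) blk
    (hasL2Majorant_add (g := toB6 g R H) blk (hasL2Majorant_add (g := toB6 g R H) blk w1 w2) w3)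
  rw [pTwo_assoc]
  refine hasL2Majorant_mono (g := toB6 g R H) blk hsum fun a b => le_of_eq ?_
  simp only [kappa383]
  ring

/-! ## §3  The `P₂(A)` words of (3.85) in block-ℓ² form: `P₂·G`, `G·P₂`, `X·P₂` -/

omit [DecidableEq g.Site] in
/-- ★ **THE WORD `P₂(A)·G(U)` OF (3.85) IN BLOCK-ℓ²**: `P₂ ≺₂ κα₁(Lʲη)⁻²e^{−ρd}` and THEOREM 3.3's (3.46)₀ `G ≺₂ B₀(Lʲη)²e^{−ρ′d}` (any `ρ′ ≦ ρ`), the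
transfer of `(Lʲη)²` at `α′` (constant `Λ′`), (2.61) at `β′`, `ρ′ + (α′+β′)δ₀ ≦ ρ` ⟹ `P₂·G ≺₂ (κα₁·B₀·Λ′c₁(β′))·e^{−ρ′d}` (scale-free: the weights cancel).
[cite: Balaban1985BackgroundPropagators, (3.83)–(3.85) p.407 + Thm 3.3 p.399 + (3.46) p.398; Balaban1984PropagatorsII, Lemma 2.1 p.234 + Prop. 2.6 (2.140)–(2.141) p.247] -/
theorem ineq385_l2_P2G (blk : W → g.Site) (d : ℕ) (δ₀ ρ α' β' ρ' Λ' κ B₀ α₁ : ℝ)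
    (hκ : 0 ≤ κ) (hB₀ : 0 ≤ B₀) (hα₁ : 0 ≤ α₁) (hΛ' : 0 ≤ Λ') (hρ' : 0 ≤ ρ') (hr' : ρ' + (α' + β') * δ₀ ≤ ρ)
    (hdnn : ∀ a b : g.Site, 0 ≤ g.dist a b) (htri : Triangle254 (toB6 g R H)) (hlen : ∀ y : g.Site, 0 < g.len y)
    (h261 : Ineq261 d (toB6 g R H) δ₀ β') (hT2 : ScaleTransfer g δ₀ α' Λ' (fun a => g.len a ^ 2))
    {P₂ G : Module.End ℝ (W → ℝ)}
    (hP₂ : HasL2Majorant (g := toB6 g R H) blk P₂ (fun a b => κ * α₁ * (g.len a ^ 2)⁻¹ * Real.exp (-(ρ * g.dist a b))))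
    (hG : HasL2Majorant (g := toB6 g R H) blk G (fun a b => B₀ * g.len a ^ 2 * Real.exp (-(ρ' * g.dist a b)))) :
    HasL2Majorant (g := toB6 g R H) blk (P₂ * G)
      (fun a b => (κ * α₁ * B₀ * Λ' * B6.c1 d δ₀ β') * Real.exp (-(ρ' * g.dist a b))) := by
  have hw2 : ∀ a : g.Site, 0 ≤ g.len a ^ 2 := fun a => sq_nonneg _
  have hw2i : ∀ a : g.Site, 0 ≤ (g.len a ^ 2)⁻¹ := fun a => inv_nonneg.mpr (sq_nonneg _)
  have h := hasL2Majorant_comp_decay (R := R) (H := H) blk d δ₀ α' β' ρ' ρ Λ' (κ * α₁) B₀ (fun a => (g.len a ^ 2)⁻¹)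
    (fun a => g.len a ^ 2) hw2i hw2 hΛ' (mul_nonneg hκ hα₁) hB₀ hρ' hr' hdnn htri hT2 h261 hP₂ hG
  refine hasL2Majorant_mono (g := toB6 g R H) blk h fun a b => le_of_eq ?_
  have ha : g.len a ≠ 0 := (hlen a).ne'
  rw [inv_mul_cancel₀ (pow_ne_zero 2 ha)]
  ring

omit [DecidableEq g.Site] in
/-- ★ **THE WORD `G(U)·P₂(A)` (right composite) IN BLOCK-ℓ²**: THEOREM 3.3's (3.46)₀ `G ≺₂ B₀(Lʲη)²e^{−ρd}`, `P₂ ≺₂ κα₁(Lʲη)⁻²e^{−ρ′d}`, the transfer of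
`(Lʲη)⁻²` at `α′` (constant `Λ′`), (2.61) at `β′`, `ρ′ + (α′+β′)δ₀ ≦ ρ` ⟹ `G·P₂ ≺₂ (B₀·κα₁·Λ′c₁(β′))·e^{−ρ′d}`.
[cite: Balaban1985BackgroundPropagators, (3.83)–(3.86) p.407 + Thm 3.3 p.399 + (3.46) p.398 + p.403 l.5–9; Balaban1984PropagatorsII, Lemma 2.1 p.234 + Prop. 2.6 (2.140)–(2.141) p.247] -/
theorem ineq385_l2_GP2 (blk : W → g.Site) (d : ℕ) (δ₀ ρ α' β' ρ' Λ' κ B₀ α₁ : ℝ)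
    (hκ : 0 ≤ κ) (hB₀ : 0 ≤ B₀) (hα₁ : 0 ≤ α₁) (hΛ' : 0 ≤ Λ') (hρ' : 0 ≤ ρ') (hr' : ρ' + (α' + β') * δ₀ ≤ ρ)
    (hdnn : ∀ a b : g.Site, 0 ≤ g.dist a b) (htri : Triangle254 (toB6 g R H)) (hlen : ∀ y : g.Site, 0 < g.len y)
    (h261 : Ineq261 d (toB6 g R H) δ₀ β') (hT2i : ScaleTransfer g δ₀ α' Λ' (fun a => (g.len a ^ 2)⁻¹))
    {P₂ G : Module.End ℝ (W → ℝ)}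
    (hG : HasL2Majorant (g := toB6 g R H) blk G (fun a b => B₀ * g.len a ^ 2 * Real.exp (-(ρ * g.dist a b))))
    (hP₂ : HasL2Majorant (g := toB6 g R H) blk P₂ (fun a b => κ * α₁ * (g.len a ^ 2)⁻¹ * Real.exp (-(ρ' * g.dist a b)))) :
    HasL2Majorant (g := toB6 g R H) blk (G * P₂)
      (fun a b => (B₀ * (κ * α₁) * Λ' * B6.c1 d δ₀ β') * Real.exp (-(ρ' * g.dist a b))) := by
  have hw2 : ∀ a : g.Site, 0 ≤ g.len a ^ 2 := fun a => sq_nonneg _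
  have hw2i : ∀ a : g.Site, 0 ≤ (g.len a ^ 2)⁻¹ := fun a => inv_nonneg.mpr (sq_nonneg _)
  have h := hasL2Majorant_comp_decay (R := R) (H := H) blk d δ₀ α' β' ρ' ρ Λ' B₀ (κ * α₁) (fun a => g.len a ^ 2)
    (fun a => (g.len a ^ 2)⁻¹) hw2 hw2i hΛ' hB₀ (mul_nonneg hκ hα₁) hρ' hr' hdnn htri hT2i h261 hG hP₂
  refine hasL2Majorant_mono (g := toB6 g R H) blk h fun a b => le_of_eq ?_
  have ha : g.len a ≠ 0 := (hlen a).ne'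
  rw [mul_inv_cancel₀ (pow_ne_zero 2 ha)]
  ring

omit [DecidableEq g.Site] in
/-- ★ **THE WORD `X·P₂(A)` AT THE LETTER ∇ (the mixed member's factor), IN BLOCK-ℓ²**: for `X ≺₂ B₀Lʲη e^{−ρd}` (print: `X = ∇_kG(U)`, THEOREM 3.3's (3.46)₁),
`P₂ ≺₂ κα₁(Lʲη)⁻²e^{−ρ′d}`, the transfer of `(Lʲη)⁻²` at `α′`, (2.61) at `β′`, `ρ′ + (α′+β′)δ₀ ≦ ρ` ⟹ `X·P₂ ≺₂ (B₀·κα₁·Λ′c₁(β′))·(Lʲη)⁻¹·e^{−ρ′d}`.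
[cite: Balaban1985BackgroundPropagators, (3.83)–(3.86) p.407 + Thm 3.3 p.399 + (3.46) p.398 + p.403 l.1–9; Balaban1984PropagatorsII, Lemma 2.1 p.234 + Prop. 2.6 (2.140)–(2.141) p.247] -/
theorem ineq385_l2_XP2 (blk : W → g.Site) (d : ℕ) (δ₀ ρ α' β' ρ' Λ' κ B₀ α₁ : ℝ)
    (hκ : 0 ≤ κ) (hB₀ : 0 ≤ B₀) (hα₁ : 0 ≤ α₁) (hΛ' : 0 ≤ Λ') (hρ' : 0 ≤ ρ') (hr' : ρ' + (α' + β') * δ₀ ≤ ρ)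
    (hdnn : ∀ a b : g.Site, 0 ≤ g.dist a b) (htri : Triangle254 (toB6 g R H)) (hlen : ∀ y : g.Site, 0 < g.len y)
    (h261 : Ineq261 d (toB6 g R H) δ₀ β') (hT2i : ScaleTransfer g δ₀ α' Λ' (fun a => (g.len a ^ 2)⁻¹))
    {P₂ X : Module.End ℝ (W → ℝ)}
    (hX : HasL2Majorant (g := toB6 g R H) blk X (fun a b => B₀ * g.len a * Real.exp (-(ρ * g.dist a b))))
    (hP₂ : HasL2Majorant (g := toB6 g R H) blk P₂ (fun a b => κ * α₁ * (g.len a ^ 2)⁻¹ * Real.exp (-(ρ' * g.dist a b)))) :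
    HasL2Majorant (g := toB6 g R H) blk (X * P₂)
      (fun a b => (B₀ * (κ * α₁) * Λ' * B6.c1 d δ₀ β') * (g.len a)⁻¹ * Real.exp (-(ρ' * g.dist a b))) := by
  have hw1 : ∀ a : g.Site, 0 ≤ g.len a := fun a => (hlen a).le
  have hw2i : ∀ a : g.Site, 0 ≤ (g.len a ^ 2)⁻¹ := fun a => inv_nonneg.mpr (sq_nonneg _)
  have h := hasL2Majorant_comp_decay (R := R) (H := H) blk d δ₀ α' β' ρ' ρ Λ' B₀ (κ * α₁) (fun a => g.len a)
    (fun a => (g.len a ^ 2)⁻¹) hw1 hw2i hΛ' hB₀ (mul_nonneg hκ hα₁) hρ' hr' hdnn htri hT2i h261 hX hP₂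
  refine hasL2Majorant_mono (g := toB6 g R H) blk h fun a b => le_of_eq ?_
  have ha : g.len a ≠ 0 := (hlen a).ne'
  have e : g.len a * (g.len a ^ 2)⁻¹ = (g.len a)⁻¹ := by field_simp
  rw [e]

end Literature.MathematicalPhysics.QuantumFieldTheory.Balaban1983to89.B9Ineq383L2
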